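/-
Copyright (c) 2026 the pub-hodgecm-mathlib formalisation cell (harness21).  Prover seat hodgecm-mathlib-K2E3-p21 (g5), Track B «K2-LIT» ∕ h413
(`stmt-HodgeConjecture-24833`), line `K2_E3_EllipticInputs`, unit U12 §L, road «GL-[M6]-sc» (line lead K2E3-p23 (g5), (M16-2) «per-point `hcanc` with explicit radius»;
T20-GL₃ co-owned with K2E5-p17 (g4)), brick T20-GL₃ (C-shell B), FILE 2: «SUPPORT OF THE SUPERCUSPIDAL SLICE (★ T18) AND THE PER-POINT `hcanc` AT A SPLIT REGULAR CLASS OF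
`G' = GL₃(F) ⧸ ϖ^ℤ·1`» = ★ (C) ∘ ★ (C-shell A) ∘ ★ (C-shell B) FILE 1.  2026-09-04.
-/
import Summits.HodgeConjecture.HodgeConjecture.Theorems.K2E3GL3SupercuspOrbitalSliceCuspidal     -- ★ (C-shell B) FILE 1 (this seat): the three cusp binders + continuity; brings ★ (C)
import Summits.HodgeConjecture.HodgeConjecture.Theorems.K2E3GL3CuspFormCancellationShell        -- ★ (C-shell A) p858388 (this seat): the descent; brings ★ B6-final chain (B0z, B2)
import Summits.HodgeConjecture.HodgeConjecture.Theorems.K2E3GL3TruncatedCharSplitTorusRadius  -- ★ T18-split (K2E3-p14 g5): `exists_adBall_mul_zpowDiagGL_of_adBall_conj`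
import Literature.NumberTheory.Automorphic.AdmissibleInvariantFormSchur                        -- ★ `IsSupercuspidal.hasCompactSupport_sesqForm_apply_apply`
import HarnessLib

/-!
# K2_E3 road (h413), T20-GL₃ (C-shell B, file 2): `supp f ⊆ 𝔅_{6s₀+L} · A` for the supercuspidal slice and THE PER-POINT `hcanc` at `ḡ = mk (y γ y⁻¹)`,
# `γ` split regular, with the explicit radius `R = m_C + 6(1 + 2s + 4 m_C) + s`, `m_C = 6 s₀ + L` (`s₀` = support height of `θ`, `L` = depth of `γ`, `s` = height of `y`)

Cell `pub/hodgecm-mathlib` (D-0151), Track B, seat K2E3-p21 (g5).  CONSUMER: ASM (K2E3-p23 (g5), (M16-2) per-point form) — feeds ★ ASM-core `nonEllEstimates_of_radius`'s `hcanc` on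
the split regular classes after the a.e. normal-form packaging (★ K2E3-p03 ∕ K2E3-p17 g7).  `--supports stmt-HodgeConjecture-24833 --as helper`; THEOREMS ONLY.

* §1 **`exists_support_height`** (`θ = B u' (ρ · u)` has compact support on `G'` — `Z(G')` compact ★ B2 + ★ B0z — hence lies in some `Ω s₀`) and **`slice_support_subset`**
  (★ (C)'s `hsupp` with `m_C = 6 s₀ + L`: `f z ≠ 0 ⇒ mk(zγz⁻¹) ∈ Ω s₀ ⇒ 𝔅_{s₀}(zγz⁻¹) ⇒` ★ T18 `∃ e, 𝔅_{6s₀+L}(z·ϖ^e)`, and `ϖ^{-e} ∈ A = M_{id}`).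
* §2 **`setIntegral_conj_eq_setIntegral_inter_split`** — for EVERY `n`: `∫_{Ω n} θ(x̄ ḡ x̄⁻¹) dμ' = ∫_{Ω n ∩ Ω R} θ(x̄ ḡ x̄⁻¹) dμ'`, `ḡ = mk (y γ y⁻¹)`, `𝔅_s(y)`,
  `R = (6s₀+L) + 6·(1 + 2s + 4(6s₀+L)) + s` — ★ (C) `cuspForm_cancellation_GL3_split` (m = 1) fed with FILE 1's binders and §1, then ★ (C-shell A)
  `setIntegral_conj_eq_setIntegral_inter_of_cuspForm_cancellation`; and **`exists_radius_setIntegral_conj_eq_setIntegral_inter_split`** (the `∃ s₀, ∀ γ y …` packaging).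
[HarishChandra1970, Part VII §2 Thm 20 p. 70, §3 pp. 71–72 (`Ω(γ)`)]; [Casselman1995, Thm. 5.3.1].

HONEST LABEL: HC_CM is proved only modulo the 7 printed citations (2 remaining named inputs: hLiu418 = `stmt-HodgeConjecture-24832`, h413 = `stmt-HodgeConjecture-24833`)
until rung 0 closes; this file is a count-neutral helper and closes no socket.

## References
* [HarishChandra1970] Harish-Chandra (notes by G. van Dijk), *Harmonic Analysis on Reductive p-adic Groups*, LNM 162 (1970), Part VII §2 Thm 20 p. 70, §3 pp. 71–73.
* [Casselman1995] W. Casselman, *Introduction to the theory of admissible representations of `p`-adic reductive groups* (1995 notes), Thm. 5.3.1, Prop. 1.4.4.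
-/

set_option autoImplicit false
-- the mandated namespace repeats the single-problem summit's segment (`HodgeConjecture.HodgeConjecture`)
set_option linter.dupNamespace false

noncomputable section

open MeasureTheory MeasureTheory.Measure Set Filter Topology
open scoped MatrixGroups Pointwise WithZero
open Literature.NumberTheory.Automorphic Literature.NumberTheory.GaloisRepresentations Literature.NumberTheory.GaloisRepresentations.IsNonarchimedeanLocalField
open Summit.HodgeConjecture.HodgeConjecture.Cruxes.H413.K2E3GL3ModCocompactFrame
open Summit.HodgeConjecture.HodgeConjecture.Cruxes.H413.K2E3GL3ModUniformizerCocompact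
open Summit.HodgeConjecture.HodgeConjecture.Cruxes.H413.K2E3GL3SupercuspOrbitalSliceCuspidal
open Summit.HodgeConjecture.HodgeConjecture.Cruxes.H413.K2E3GL3CuspFormCancellationShell
open Summit.HodgeConjecture.HodgeConjecture.Cruxes.H413.K2E3GL3CuspFormCancellation (cuspForm_cancellation_GL3_split)
open Summit.HodgeConjecture.HodgeConjecture.Cruxes.H413.K2E3GL3TruncatedCharSplitTorusRadius (exists_adBall_mul_zpowDiagGL_of_adBall_conj)

namespace Summit.HodgeConjecture.HodgeConjecture.Cruxes.H413.K2E3GL3SupercuspOrbitalSliceCancellation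

variable {F : Type*} [Field F] [Valued F ℤᵐ⁰] [ValuativeRel F] [(Valued.v : Valuation F ℤᵐ⁰).Compatible] [IsNonarchimedeanLocalField F] [CharZero F]
  [MeasurableSpace F] [BorelSpace F] [MeasurableSpace (GL (Fin 3) F)] [BorelSpace (GL (Fin 3) F)]
  {ϖ : F} (hϖ : Valued.v ϖ = WithZero.exp (-1 : ℤ)) (hϖ0 : ϖ ≠ 0)
  [((Subgroup.zpowers (Units.mk0 ϖ hϖ0)).map (Matrix.GeneralLinearGroup.scalar (Fin 3))).Normal]
  [MeasurableSpace (GL (Fin 3) F ⧸ (Subgroup.zpowers (Units.mk0 ϖ hϖ0)).map (Matrix.GeneralLinearGroup.scalar (Fin 3)))]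
  [BorelSpace (GL (Fin 3) F ⧸ (Subgroup.zpowers (Units.mk0 ϖ hϖ0)).map (Matrix.GeneralLinearGroup.scalar (Fin 3)))]
  {V : Type*} [AddCommGroup V] [Module ℂ V] (ρ : Representation ℂ (GL (Fin 3) F ⧸ (Subgroup.zpowers (Units.mk0 ϖ hϖ0)).map (Matrix.GeneralLinearGroup.scalar (Fin 3))) V)
  (hρ : ρ.IsSmooth) (hsc : ρ.IsSupercuspidal) {B : V →ₗ⋆[ℂ] V →ₗ[ℂ] ℂ}
  (hBinv : ∀ (g : GL (Fin 3) F ⧸ (Subgroup.zpowers (Units.mk0 ϖ hϖ0)).map (Matrix.GeneralLinearGroup.scalar (Fin 3))) (v w : V), B (ρ g v) (ρ g w) = B v w) (u u' : V)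
  (Ω : CompactExhaustion (GL (Fin 3) F ⧸ (Subgroup.zpowers (Units.mk0 ϖ hϖ0)).map (Matrix.GeneralLinearGroup.scalar (Fin 3))))
  (hmem : ∀ (m : ℕ) (g : GL (Fin 3) F),
    (QuotientGroup.mk g : GL (Fin 3) F ⧸ (Subgroup.zpowers (Units.mk0 ϖ hϖ0)).map (Matrix.GeneralLinearGroup.scalar (Fin 3))) ∈ Ω m ↔
      ∀ i j k l, Valued.v (ϖ ^ m * ((g : Matrix (Fin 3) (Fin 3) F) i j * ((g⁻¹ : GL (Fin 3) F) : Matrix (Fin 3) (Fin 3) F) k l)) ≤ 1)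

/-! ## §1  The support of the slice -/

omit [MeasurableSpace F] [BorelSpace F] [MeasurableSpace (GL (Fin 3) F)] [BorelSpace (GL (Fin 3) F)]
  [MeasurableSpace (GL (Fin 3) F ⧸ (Subgroup.zpowers (Units.mk0 ϖ hϖ0)).map (Matrix.GeneralLinearGroup.scalar (Fin 3)))] [BorelSpace (GL (Fin 3) F ⧸ (Subgroup.zpowers (Units.mk0 ϖ hϖ0)).map (Matrix.GeneralLinearGroup.scalar (Fin 3)))] in
include hϖ hρ hsc hBinv in
/-- **SUPPORT HEIGHT OF THE COEFFICIENT**: `θ = B u' (ρ · u)` is compactly supported on `G' = GL₃(F) ⧸ ϖ^ℤ·1` (★ `IsSupercuspidal.hasCompactSupport_sesqForm_apply_apply`, `Z(G')` compact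
★ B2 `isCompact_center_quotScalar` + ★ B0z), hence `θ ≠ 0` only inside some ball `Ω s₀`. [cite: HarishChandra1970, Part I §3 p. 9] -/
theorem exists_support_height : ∃ s₀ : ℕ, ∀ g : GL (Fin 3) F ⧸ (Subgroup.zpowers (Units.mk0 ϖ hϖ0)).map (Matrix.GeneralLinearGroup.scalar (Fin 3)),
    B u' (ρ g u) ≠ 0 → g ∈ Ω s₀ := by
  haveI : CompactSpace (Fˣ ⧸ Subgroup.zpowers (Units.mk0 ϖ hϖ0)) := compactSpace_units_quot_zpowers_uniformizer hϖ hϖ0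
  have hZ := isCompact_center_quotScalar (F := F) (Subgroup.zpowers (Units.mk0 ϖ hϖ0))
  have hcs : HasCompactSupport fun g : GL (Fin 3) F ⧸ (Subgroup.zpowers (Units.mk0 ϖ hϖ0)).map (Matrix.GeneralLinearGroup.scalar (Fin 3)) => B u' (ρ g u) :=
    hsc.hasCompactSupport_sesqForm_apply_apply hZ hρ hBinv u u'
  obtain ⟨s₀, hs₀⟩ := Ω.exists_superset_of_isCompact hcs.isCompact
  exact ⟨s₀, fun g hg => hs₀ (subset_tsupport _ (Function.mem_support.2 hg))⟩

omit [ValuativeRel F] [(Valued.v : Valuation F ℤᵐ⁰).Compatible] [IsNonarchimedeanLocalField F] [CharZero F] [MeasurableSpace F] [BorelSpace F]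
  [MeasurableSpace (GL (Fin 3) F)] [BorelSpace (GL (Fin 3) F)] [((Subgroup.zpowers (Units.mk0 ϖ hϖ0)).map (Matrix.GeneralLinearGroup.scalar (Fin 3))).Normal]
  [MeasurableSpace (GL (Fin 3) F ⧸ (Subgroup.zpowers (Units.mk0 ϖ hϖ0)).map (Matrix.GeneralLinearGroup.scalar (Fin 3)))] [BorelSpace (GL (Fin 3) F ⧸ (Subgroup.zpowers (Units.mk0 ϖ hϖ0)).map (Matrix.GeneralLinearGroup.scalar (Fin 3)))] in
include hϖ hmem in
/-- **(hsupp) THE SLICE IS SUPPORTED IN `𝔅_{6s₀+L} · A`**: if `θ ≠ 0` only inside `Ω s₀` and `γ = diagonal d` has depth `L` (`|ϖ^L (d₀d₁d₂)²| ≤ |Δ(d)²|`), then `f z = θ(mk(zγz⁻¹)) ≠ 0`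
forces `z ∈ 𝔅_{6s₀+L} · M_{id}` (★ T18 `exists_adBall_mul_zpowDiagGL_of_adBall_conj`: `z·ϖ^e ∈ 𝔅_{6s₀+L}`, and `ϖ^{-e} ∈ M_{id}`) — ★ (C)'s binder `hsupp` with `m_C = 6s₀ + L`.
[cite: HarishChandra1970, Part VII §3 p. 72 (`Ω(γ)`)] -/
theorem slice_support_subset (θ : GL (Fin 3) F ⧸ (Subgroup.zpowers (Units.mk0 ϖ hϖ0)).map (Matrix.GeneralLinearGroup.scalar (Fin 3)) → ℂ) {s₀ : ℕ}
    (hθ : ∀ g, θ g ≠ 0 → g ∈ Ω s₀) {γ : GL (Fin 3) F} {d : Fin 3 → F} (hγ : (γ : Matrix (Fin 3) (Fin 3) F) = Matrix.diagonal d) {L : ℕ}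
    (hD : Valued.v (ϖ ^ L * (d 0 * d 1 * d 2) ^ 2) ≤ Valued.v (((d 0 - d 1) * (d 0 - d 2) * (d 1 - d 2)) ^ 2)) (z : GL (Fin 3) F)
    (hz : θ (QuotientGroup.mk (z * γ * z⁻¹)) ≠ 0) :
    z ∈ {x : GL (Fin 3) F | ∀ i j k l, Valued.v (ϖ ^ (6 * s₀ + L) * ((x : Matrix (Fin 3) (Fin 3) F) i j * ((x⁻¹ : GL (Fin 3) F) : Matrix (Fin 3) (Fin 3) F) k l)) ≤ 1} *
      ((standardLeviGL F (id : Fin 3 → Fin 3) : Subgroup (GL (Fin 3) F)) : Set (GL (Fin 3) F)) := by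
  have hball := (hmem s₀ (z * γ * z⁻¹)).1 (hθ _ hz)
  obtain ⟨e, he⟩ := exists_adBall_mul_zpowDiagGL_of_adBall_conj hϖ hϖ0 hγ hball hD
  refine Set.mem_mul.2 ⟨z * zpowDiagGL hϖ0 e, he, (zpowDiagGL hϖ0 e)⁻¹, Subgroup.inv_mem _ (zpowDiagGL_mem_standardLeviGL _ hϖ0 e), by rw [mul_inv_cancel_right]⟩

/-! ## §2  The per-point `hcanc` at a split regular class -/

variable (hK : ∀ (m : ℕ) (k : GL (Fin 3) F), k ∈ glInt 3 F → ∀ x : GL (Fin 3) F ⧸ (Subgroup.zpowers (Units.mk0 ϖ hϖ0)).map (Matrix.GeneralLinearGroup.scalar (Fin 3)),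
    ((QuotientGroup.mk k : GL (Fin 3) F ⧸ _) * x ∈ Ω m ↔ x ∈ Ω m) ∧ (x * (QuotientGroup.mk k : GL (Fin 3) F ⧸ _) ∈ Ω m ↔ x ∈ Ω m))
  (μ' : Measure (GL (Fin 3) F ⧸ (Subgroup.zpowers (Units.mk0 ϖ hϖ0)).map (Matrix.GeneralLinearGroup.scalar (Fin 3)))) [μ'.IsHaarMeasure]

include hϖ hρ hsc hBinv hmem hK in
/-- **THE PER-POINT `hcanc` AT A SPLIT REGULAR CLASS `ḡ = mk (y γ y⁻¹)`**: `γ = diagonal d` regular of depth `L`, `𝔅_s(y)`, `θ = B u' (ρ · u)` supported in `Ω s₀`; then for EVERY `n`,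
`∫_{Ω n} θ(x̄ ḡ x̄⁻¹) dμ'(x̄) = ∫_{Ω n ∩ Ω R} θ(x̄ ḡ x̄⁻¹) dμ'(x̄)` with `R = (6s₀+L) + 6·(1 + 2s + 4·(6s₀+L)) + s` — ★ (C) `cuspForm_cancellation_GL3_split` (`m = 1`) with ★ FILE 1's
binders and §1's support, descended by ★ (C-shell A). [cite: HarishChandra1970, Part VII §2 Thm 20 p. 70, §3 pp. 71–72] [cite: Casselman1995, Thm. 5.3.1] -/
theorem setIntegral_conj_eq_setIntegral_inter_split {s₀ : ℕ}
    (hθ : ∀ g : GL (Fin 3) F ⧸ (Subgroup.zpowers (Units.mk0 ϖ hϖ0)).map (Matrix.GeneralLinearGroup.scalar (Fin 3)), B u' (ρ g u) ≠ 0 → g ∈ Ω s₀)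
    {γ : GL (Fin 3) F} {d : Fin 3 → F} (hγ : (γ : Matrix (Fin 3) (Fin 3) F) = Matrix.diagonal d) (hd : Function.Injective d) {L : ℕ}
    (hD : Valued.v (ϖ ^ L * (d 0 * d 1 * d 2) ^ 2) ≤ Valued.v (((d 0 - d 1) * (d 0 - d 2) * (d 1 - d 2)) ^ 2))
    {s : ℕ} {y : GL (Fin 3) F} (hy : ∀ i j k l, Valued.v (ϖ ^ s * ((y : Matrix (Fin 3) (Fin 3) F) i j * ((y⁻¹ : GL (Fin 3) F) : Matrix (Fin 3) (Fin 3) F) k l)) ≤ 1)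
    (n : ℕ) :
    ∫ x in Ω n, B u' (ρ (x * QuotientGroup.mk (y * γ * y⁻¹) * x⁻¹) u) ∂μ' =
      ∫ x in Ω n ∩ Ω ((6 * s₀ + L) + 6 * (1 + 2 * s + 4 * (6 * s₀ + L)) + s), B u' (ρ (x * QuotientGroup.mk (y * γ * y⁻¹) * x⁻¹) u) ∂μ' := by
  haveI : SecondCountableTopology (GL (Fin 3) F) := K2E3GL3ModCentre.secondCountableTopology_gl3 F
  haveI : LocallyCompactSpace (GL (Fin 3) F) := K2E3GL3ModCentre.locallyCompactSpace_gl3 F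
  set μ : Measure (GL (Fin 3) F) := Measure.haar with hμ
  have hθc : Continuous fun g : GL (Fin 3) F ⧸ (Subgroup.zpowers (Units.mk0 ϖ hϖ0)).map (Matrix.GeneralLinearGroup.scalar (Fin 3)) => B u' (ρ g u) :=
    ((Representation.IsSmooth.isLocallyConstant_apply ρ hρ u).comp fun w : V => B u' w).continuous
  refine setIntegral_conj_eq_setIntegral_inter_of_cuspForm_cancellation hϖ hϖ0 μ μ' Ω hmem hK (fun g => B u' (ρ g u)) hθc γ y (fun x hx => ?_) n
  exact cuspForm_cancellation_GL3_split hϖ μ (le_refl 1) hy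
    (fun z : GL (Fin 3) F => B u' (ρ (QuotientGroup.mk (z * γ * z⁻¹) : GL (Fin 3) F ⧸ (Subgroup.zpowers (Units.mk0 ϖ hϖ0)).map (Matrix.GeneralLinearGroup.scalar (Fin 3))) u))
    (continuous_slice _ ρ hρ γ u u') (fun z hz => slice_support_subset hϖ hϖ0 Ω hmem _ hθ hγ hD z hz)
    (fun σ ν₀ hν₀ x' => by haveI := hν₀; exact slice_hcuspB _ ρ hρ hsc hBinv hγ hd u u' σ ν₀ x')
    (fun σ ν₀ hν₀ x' => by haveI := hν₀; exact slice_hcusp12 _ ρ hρ hsc hBinv hγ hd u u' σ ν₀ x')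
    (fun σ ν₀ hν₀ x' => by haveI := hν₀; exact slice_hcusp21 _ ρ hρ hsc hBinv hγ hd u u' σ ν₀ x') hx

include hϖ hρ hsc hBinv hmem hK in
/-- **THE RADIUS PACKAGE FOR ASM ((M16-2), per-point form)**: there is a support height `s₀` of `θ = B u' (ρ · u)` such that for EVERY split regular `γ = diagonal d` of depth `L`,
every `y` with `𝔅_s(y)` and every `n`: `∫_{Ω n} θ(x̄·mk(yγy⁻¹)·x̄⁻¹) dμ' = ∫_{Ω n ∩ Ω R} …` with `R = (6s₀+L) + 6(1 + 2s + 4(6s₀+L)) + s` (linear in `s₀, L, s`).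
[cite: HarishChandra1970, Part VII §3 p. 72 (`Ω(γ)`)] -/
theorem exists_radius_setIntegral_conj_eq_setIntegral_inter_split :
    ∃ s₀ : ℕ, ∀ {γ : GL (Fin 3) F} {d : Fin 3 → F}, (γ : Matrix (Fin 3) (Fin 3) F) = Matrix.diagonal d → Function.Injective d → ∀ {L : ℕ},
      Valued.v (ϖ ^ L * (d 0 * d 1 * d 2) ^ 2) ≤ Valued.v (((d 0 - d 1) * (d 0 - d 2) * (d 1 - d 2)) ^ 2) →
      ∀ {s : ℕ} {y : GL (Fin 3) F}, (∀ i j k l, Valued.v (ϖ ^ s * ((y : Matrix (Fin 3) (Fin 3) F) i j * ((y⁻¹ : GL (Fin 3) F) : Matrix (Fin 3) (Fin 3) F) k l)) ≤ 1) →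
      ∀ n : ℕ, ∫ x in Ω n, B u' (ρ (x * QuotientGroup.mk (y * γ * y⁻¹) * x⁻¹) u) ∂μ' =
        ∫ x in Ω n ∩ Ω ((6 * s₀ + L) + 6 * (1 + 2 * s + 4 * (6 * s₀ + L)) + s), B u' (ρ (x * QuotientGroup.mk (y * γ * y⁻¹) * x⁻¹) u) ∂μ' := by
  obtain ⟨s₀, hs₀⟩ := exists_support_height hϖ hϖ0 ρ hρ hsc hBinv u u' Ω
  exact ⟨s₀, fun hγ hd _ hD _ _ hy n => setIntegral_conj_eq_setIntegral_inter_split hϖ hϖ0 ρ hρ hsc hBinv u u' Ω hmem hK μ' hs₀ hγ hd hD hy n⟩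

end Summit.HodgeConjecture.HodgeConjecture.Cruxes.H413.K2E3GL3SupercuspOrbitalSliceCancellation

end
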